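import Literature.Barriers.AtomisticToContinuum.AnticontinuumLocalizationZeroSet
import HarnessLib

/-!
# De Roeck–Huveneers 2015, §5.4–5.5 for the rotor chain, II: the crucial cancellation and `A = 0` off `Z`

`Literature/Barriers/AtomisticToContinuum/` — continuation of `AnticontinuumLocalizationZeroSet.lean`.
PROVED here, for the explicit objects of the previous files (scheme radius `r`, cut-offs `Θ`, bond `a`
(`b`), radius `n₃`, a ROOM witness, `Rz ≥ n₃ + max(4r, RS)`, scale `δ ∈ (0,1]`):

* **the crucial cancellation** of §5.4: where `θ_x(ω) > 0`,
  `∑_{i+j=l} {H̃^{(i)}, H̃^{(j)}_{>x}}(q, ω) = 0` (`cancellation`): the `{>x, >x}` part is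
  antisymmetric, and each close pair `{t_{≤x}, t'_{>x}}` vanishes because a nonzero mode of either
  term lies in `K_r(B(x,4r))`, is non-resonant at `ω`, so that resonant term vanishes near `(q, ω)`;
* **Lemma 4, first claim**: off `Z`, `{H̃^{(i)}, ϑ_{a,x}} = {H̃^{(i)}, ϑ_*} = 0` and `ϑ_* = 0`, hence every
  coefficient of `H̃ · H̃_{>a}` vanishes at `(q, ω)` for all `q` (`mul_hgt_coeff_eq_zero`), and so do
  all coefficients of `R(H̃ · H̃_{>a})` and the function `A = 𝒯(R(H̃ · H̃_{>a}))`
  (`Aterm_eq_zero_of_not_mem_Zset`: "If `L_H̃ H̃_{>a}(ω,q) ≠ 0`, then `(ω,q) ∈ Z`").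
-/

noncomputable section

open Function Set Finset Filter Metric
open scoped ContDiff BigOperators Topology

namespace Literature.Barriers.AtomisticToContinuum.HeatConduction.RotorChain

open Literature.MathematicalPhysics.KineticTheory.HeatConduction
open Literature.Analysis.Calculus Literature.Analysis.Calculus.IsDeltaSymbol
open Literature.Algebra.Lie Literature.Algebra.Lie.TruncSeries

variable {m : ℕ}

/-! ### List-level bilinearity of the bracket -/

/-- `{ev F, g} = ∑_{t ∈ F} {t, g}` (differentiable coefficients and `g`). [folklore] -/
theorem poisson_ev_left (F : TrigPoly m) {δ : ℝ} (hF : F.SmoothAt δ) (g : PhaseSpace m → ℝ)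
    (z : PhaseSpace m) : poisson (TrigPoly.ev F δ) g z = (F.map fun t => poisson (t.ev δ) g z).sum := by
  induction F with
  | nil =>
    have e : TrigPoly.ev ([] : TrigPoly m) δ = fun _ => (0 : ℝ) := funext fun z => TrigPoly.ev_nil δ z
    rw [e]; simp [poisson_const_left]
  | cons t F ih =>
    have ht := hF t (by simp)
    have hF' : TrigPoly.SmoothAt F δ := fun s hs => hF s (by simp [hs])
    have e : TrigPoly.ev (t :: F) δ = (t.ev δ) + TrigPoly.ev F δ := funext fun z => TrigPoly.ev_cons t F δ z
    rw [e, poisson_add_left (t.differentiable_ev ht.differentiable.1 ht.differentiable.2)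
      (TrigPoly.differentiable_ev F fun s hs => (hF' s hs).differentiable), ih hF']
    simp

/-- `{f, ev G} = ∑_{t' ∈ G} {f, t'}`. [folklore] -/
theorem poisson_ev_right (f : PhaseSpace m → ℝ) (G : TrigPoly m) {δ : ℝ} (hG : G.SmoothAt δ) (z : PhaseSpace m) :
    poisson f (TrigPoly.ev G δ) z = (G.map fun t' => poisson f (t'.ev δ) z).sum := by
  induction G with
  | nil =>
    have e : TrigPoly.ev ([] : TrigPoly m) δ = fun _ => (0 : ℝ) := funext fun z => TrigPoly.ev_nil δ z
    rw [e]; simp [poisson_const_right]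
  | cons t G ih =>
    have ht := hG t (by simp)
    have hG' : TrigPoly.SmoothAt G δ := fun s hs => hG s (by simp [hs])
    have e : TrigPoly.ev (t :: G) δ = (t.ev δ) + TrigPoly.ev G δ := funext fun z => TrigPoly.ev_cons t G δ z
    rw [e, poisson_add_right f (t.differentiable_ev ht.differentiable.1 ht.differentiable.2)
      (TrigPoly.differentiable_ev G fun s hs => (hG' s hs).differentiable), ih hG']
    simp

/-- A list sum of zeros. [folklore] -/
theorem list_sum_map_eq_zero {α : Type*} {l : List α} {f : α → ℝ} (h : ∀ a ∈ l, f a = 0) : (l.map f).sum = 0 := by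
  rw [List.sum_eq_zero]
  intro x hx
  obtain ⟨a, ha, rfl⟩ := List.mem_map.1 hx
  exact h a ha

/-- **Antisymmetric antidiagonal sums vanish**: `∑_{i+j=l} {f_i, f_j} = 0`. [cite: DeRoeckHuveneers2015, §5.4 ("`L_H̃ ∑_{y>x} H̃_y = {∑_{z≤x} H̃_z, ∑_{y>x} H̃_y}`": the `{>x, >x}` part drops)] -/
theorem sum_antidiagonal_poisson_self (f : ℕ → PhaseSpace m → ℝ) (l : ℕ) (z : PhaseSpace m) :
    ∑ p ∈ antidiagonal l, poisson (f p.1) (f p.2) z = 0 := by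
  have h := Finset.Nat.sum_antidiagonal_swap (n := l) (f := fun p => poisson (f p.1) (f p.2) z)
  simp only [Prod.fst_swap, Prod.snd_swap] at h
  have h2 : ∑ p ∈ antidiagonal l, poisson (f p.2) (f p.1) z = -∑ p ∈ antidiagonal l, poisson (f p.1) (f p.2) z := by
    rw [← Finset.sum_neg_distrib]
    exact Finset.sum_congr rfl fun p _ => poisson_antisymm _ _ _
  linarith

section Main

variable {r L n₂ : ℕ} {Θ : ResonanceCutoffs m r L n₂} {b : Fin m} {n₃ : ℕ} {γ : ℝ} {n : ℕ} {δ : ℝ}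

/-! ### Brackets of `H̃` with the partition vanish off `Z` -/

/-- **`{t, θ-functions} = 0` at multi-resonance-free momenta**: for a term `t` of `H̃^{(i)}` and a
differentiable `g(ω)` whose derivative along every `2δ`-resonant `k ∈ K_r` vanishes at `ω` wherever
all `∂_k θ_y(ω)` (`y ∈ B(a,n₃)`) do. [cite: DeRoeckHuveneers2015, §5.5 proof of Lemma 4, first claim, with §4.3 (proof of Prop. 2: "It is thus enough to show that `k·∇_ω θ_x(ω) = 0` …")] -/
theorem poisson_term_comp_snd_eq_zero (hδ : 0 < δ) (hδ1 : δ ≤ 1) (hr : IsSchemeRadius n r) {i : ℕ} (hi : i ≤ n)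
    {t : TrigTerm m} (ht : t ∈ normalForm m γ n i) {g : (Fin m → ℝ) → ℝ} (hg : Differentiable ℝ g) {w : Fin m → ℝ}
    (hgk : ∀ k, IsKMode r k → |modeFreq k w| ≤ 2 * δ →
      (∀ y ∈ nearSites b n₃, fderiv ℝ (Θ.θ y δ) w (modeVec k) = 0) → fderiv ℝ g w (modeVec k) = 0)
    (hw : ∀ y ∈ nearSites b n₃, w ∉ Θ.multiRes y δ) (q : Fin m → ℝ) :
    poisson (t.ev δ) (fun z : PhaseSpace m => g z.2) (q, w) = 0 := by
  rw [poisson_ev_comp_snd t δ hg]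
  by_cases hk : t.mode = 0
  · have : modeVec t.mode = 0 := by rw [hk]; funext y; simp [modeVec]
    rw [this, map_zero, mul_zero]
  · have hKM := isKMode_of_mem_normalForm hr γ hi ht hk
    by_cases hres : 2 * δ ≤ |modeFreq t.mode w|
    · -- resonant term, non-resonant momentum: coefficients vanish (`i ≥ 1` since `H̃^{(0)} = D` has zero modes)
      have hi1 : 1 ≤ i := by
        rcases Nat.eq_zero_or_pos i with h0 | h0
        · subst h0; exact absurd (normalForm_zero_mode γ n ht) hk
        · exact h0
      have hR := normalForm_resonantOnly (m := m) γ hi1 hi hδ t ht w hres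
      simp only [hR.1, hR.2, zero_mul, sub_zero]
    · rw [hgk t.mode hKM (le_of_lt (not_le.1 hres)) fun y hy => Θ.fderiv_eq_zero δ hδ hδ1 y w (hw y hy) t.mode hKM
        (le_of_lt (not_le.1 hres)), mul_zero]

/-- **`{H̃^{(i)}, ϑ_{a,x}}(q, ω) = 0` off `Z`** (`x ∈ B(a,n₃)`). [cite: DeRoeckHuveneers2015, §5.5 proof of Lemma 4, first claim] -/
theorem poisson_normalForm_vt_eq_zero (hδ : 0 < δ) (hδ1 : δ ≤ 1) (hr : IsSchemeRadius n r) {i : ℕ} (hi : i ≤ n)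
    {x : Fin m} (hx : x ∈ nearSites b n₃) {w : Fin m → ℝ} (hw : ∀ y ∈ nearSites b n₃, w ∉ Θ.multiRes y δ) (q : Fin m → ℝ) :
    poisson (TrigPoly.ev (normalForm m γ n i) δ) (fun z : PhaseSpace m => vt Θ b n₃ x δ z.2) (q, w) = 0 := by
  have hdiff : Differentiable ℝ (vt Θ b n₃ x δ) := (contDiff_vt hδ hδ1 x).differentiable (by simp)
  rw [poisson_ev_left (normalForm m γ n i) (stage_good m γ n δ n i hi).2 (fun z : PhaseSpace m => vt Θ b n₃ x δ z.2)]
  refine list_sum_map_eq_zero fun t ht => ?_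
  exact poisson_term_comp_snd_eq_zero hδ hδ1 hr hi ht hdiff
    (fun k _ _ hθ => fderiv_vt_apply_eq_zero hδ hδ1 hθ hx) hw q

/-- **`{H̃^{(i)}, ϑ_*}(q, ω) = 0` off `Z`.** [cite: DeRoeckHuveneers2015, §5.5 proof of Lemma 4, first claim] -/
theorem poisson_normalForm_vtStar_eq_zero (hδ : 0 < δ) (hδ1 : δ ≤ 1) (hr : IsSchemeRadius n r) {i : ℕ} (hi : i ≤ n)
    {w : Fin m → ℝ} (hw : ∀ y ∈ nearSites b n₃, w ∉ Θ.multiRes y δ) (q : Fin m → ℝ) :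
    poisson (TrigPoly.ev (normalForm m γ n i) δ) (fun z : PhaseSpace m => vtStar Θ b n₃ δ z.2) (q, w) = 0 := by
  have hdiff : Differentiable ℝ (vtStar Θ b n₃ δ) := (contDiff_vtStar hδ hδ1).differentiable (by simp)
  rw [poisson_ev_left (normalForm m γ n i) (stage_good m γ n δ n i hi).2 (fun z : PhaseSpace m => vtStar Θ b n₃ δ z.2)]
  refine list_sum_map_eq_zero fun t ht => ?_
  exact poisson_term_comp_snd_eq_zero hδ hδ1 hr hi ht hdiff
    (fun k _ _ hθ => fderiv_vtStar_apply_eq_zero hδ hδ1 hθ) hw q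

/-! ### The crucial cancellation -/

/-- On a line, a site between two others is within their distance of the left one. [folklore] -/
theorem dist_le_of_between {a x c : Fin m} (hax : a ≤ x) (hxc : x < c) : Nat.dist x.val a.val ≤ Nat.dist a.val c.val := by
  have h1 : a.val ≤ x.val := hax
  have h2 : x.val < c.val := hxc
  unfold Nat.dist; omega

/-- Symmetric version. [folklore] -/
theorem dist_le_of_between' {a x c : Fin m} (hax : a ≤ x) (hxc : x < c) : Nat.dist x.val c.val ≤ Nat.dist a.val c.val := by
  have h1 : a.val ≤ x.val := hax
  have h2 : x.val < c.val := hxc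
  unfold Nat.dist; omega

/-- **A close pair `{t_{≤x}, t'_{>x}}` of terms of `H̃` has zero bracket at non-resonant momenta**
(every `k ∈ K_r(B(x,4r))` satisfies `|k·ω| > 2δ`): zero modes bracket to zero, and a nonzero mode of
either term is such a `k`, so that (resonant) term vanishes near `(q, ω)`. [cite: DeRoeckHuveneers2015, §5.4 ("all the factors `ρ_δ(k·ω)` … vanish"; "since `D̃_z, D̃_y` depend only on the `ω`-variables, their Poisson bracket vanishes")] -/
theorem poisson_head_tail_term_eq_zero (hδ : 0 < δ) (hr : IsSchemeRadius n r) {i j : ℕ} (hi : i ≤ n) (hj : j ≤ n)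
    {x : Fin m} {w : Fin m → ℝ} (hnr : ∀ k, IsKMode r k → ModeNear x (4 * r) k → 2 * δ < |modeFreq k w|)
    {t t' : TrigTerm m} (ht : t ∈ normalForm m γ n i) (htx : t.pos ≤ x) (ht' : t' ∈ normalForm m γ n j)
    (ht'x : x < t'.pos) (q : Fin m → ℝ) : poisson (t.ev δ) (t'.ev δ) (q, w) = 0 := by
  have hG := stage_good m γ n δ n i hi
  have hG' := stage_good m γ n δ n j hj
  have hs := hG.2 t ht
  have hs' := hG'.2 t' ht'
  have hdt : Differentiable ℝ (t.ev δ) := t.differentiable_ev hs.differentiable.1 hs.differentiable.2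
  have hdt' : Differentiable ℝ (t'.ev δ) := t'.differentiable_ev hs'.differentiable.1 hs'.differentiable.2
  by_cases hfar : stageRad n n + stageRad n n < Nat.dist t.pos.val t'.pos.val
  · exact TrigTerm.poisson_ev_ev_eq_zero_of_far t t' (hG.1 t ht) (hG'.1 t' ht') hfar hs.differentiable.1
      hs.differentiable.2 hs'.differentiable.1 hs'.differentiable.2 _
  · have hclose : Nat.dist t.pos.val t'.pos.val ≤ 2 * stageRad n n := by omega
    by_cases hk : t.mode = 0
    · by_cases hk' : t'.mode = 0
      · exact poisson_ev_ev_of_mode_zero hk hk' δ _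
      · -- `t'` resonant, its mode non-resonant at `w`
        have hj1 : 1 ≤ j := by
          rcases Nat.eq_zero_or_pos j with h0 | h0
          · subst h0; exact absurd (normalForm_zero_mode γ n ht') hk'
          · exact h0
        have hnear : ModeNear x (4 * r) t'.mode :=
          modeNear_of_anchor (fun y hy => mode_eq_zero_of_far hr γ hj ht' hy)
            ((dist_le_of_between' htx ht'x).trans hclose) (by linarith [hr.2])
        have hz := hnr t'.mode (isKMode_of_mem_normalForm hr γ hj ht' hk') hnear
        exact poisson_eq_zero_of_fderiv_eq_zero hdt hdt'
          (fderiv_ev_eq_zero_of_nonres (normalForm_resonantOnly γ hj1 hj hδ t' ht') (z := (q, w)) hz)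
    · have hi1 : 1 ≤ i := by
        rcases Nat.eq_zero_or_pos i with h0 | h0
        · subst h0; exact absurd (normalForm_zero_mode γ n ht) hk
        · exact h0
      have hnear : ModeNear x (4 * r) t.mode :=
        modeNear_of_anchor (fun y hy => mode_eq_zero_of_far hr γ hi ht hy)
          ((dist_le_of_between htx ht'x).trans hclose) (by linarith [hr.2])
      have hz := hnr t.mode (isKMode_of_mem_normalForm hr γ hi ht hk) hnear
      exact poisson_eq_zero_of_fderiv_eq_zero_left hdt hdt'
        (fderiv_ev_eq_zero_of_nonres (normalForm_resonantOnly γ hi1 hi hδ t ht) (z := (q, w)) hz)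

/-- `{H̃^{(i)}_{≤x}, H̃^{(j)}_{>x}}(q, ω) = 0` at non-resonant momenta. [cite: DeRoeckHuveneers2015, §5.4 (the crucial cancellation "`ϑ_{a,x} · (L_H̃ ∑_{y>x} H̃_y) = 0`")] -/
theorem poisson_head_tail_eq_zero (hδ : 0 < δ) (hr : IsSchemeRadius n r) {i j : ℕ} (hi : i ≤ n) (hj : j ≤ n)
    {x : Fin m} {w : Fin m → ℝ} (hnr : ∀ k, IsKMode r k → ModeNear x (4 * r) k → 2 * δ < |modeFreq k w|)
    (q : Fin m → ℝ) :
    poisson (TrigPoly.ev (headP x (normalForm m γ n i)) δ) (TrigPoly.ev (tailP x (normalForm m γ n j)) δ) (q, w) = 0 := by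
  have hH : TrigPoly.SmoothAt (headP x (normalForm m γ n i)) δ := ((stage_good m γ n δ n i hi).filter _).2
  have hT : TrigPoly.SmoothAt (tailP x (normalForm m γ n j)) δ := ((stage_good m γ n δ n j hj).filter _).2
  rw [poisson_ev_left (headP x (normalForm m γ n i)) hH]
  refine list_sum_map_eq_zero fun t ht => ?_
  rw [poisson_ev_right _ (tailP x (normalForm m γ n j)) hT]
  refine list_sum_map_eq_zero fun t' ht' => ?_
  exact poisson_head_tail_term_eq_zero hδ hr hi hj hnr (mem_headP.1 ht).1 (mem_headP.1 ht).2 (mem_tailP.1 ht').1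
    (mem_tailP.1 ht').2 q

/-- **The crucial cancellation**: at momenta where every `k ∈ K_r(B(x,4r))` is non-resonant,
`∑_{i+j=l} {H̃^{(i)}, H̃^{(j)}_{>x}}(q, ω) = 0`. [cite: DeRoeckHuveneers2015, §5.4 (the crucial cancellation "`ϑ_{a,x} · (L_H̃ ∑_{y>x} H̃_y) = 0` for all `x ∈ B(a,n₃)`")] -/
theorem cancellation (hδ : 0 < δ) (hr : IsSchemeRadius n r) {l : ℕ} (hl : l ≤ n) {x : Fin m} {w : Fin m → ℝ}
    (hnr : ∀ k, IsKMode r k → ModeNear x (4 * r) k → 2 * δ < |modeFreq k w|) (q : Fin m → ℝ) :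
    ∑ p ∈ antidiagonal l, poisson (TrigPoly.ev (normalForm m γ n p.1) δ)
      (TrigPoly.ev (tailP x (normalForm m γ n p.2)) δ) (q, w) = 0 := by
  have hsplit : ∀ p ∈ antidiagonal l, poisson (TrigPoly.ev (normalForm m γ n p.1) δ)
      (TrigPoly.ev (tailP x (normalForm m γ n p.2)) δ) (q, w) =
      poisson (TrigPoly.ev (tailP x (normalForm m γ n p.1)) δ) (TrigPoly.ev (tailP x (normalForm m γ n p.2)) δ) (q, w) := by
    intro p hp
    have hp' := Finset.mem_antidiagonal.1 hp
    have hp1 : p.1 ≤ n := by omega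
    have hp2 : p.2 ≤ n := by omega
    have e : TrigPoly.ev (normalForm m γ n p.1) δ =
        TrigPoly.ev (tailP x (normalForm m γ n p.1)) δ + TrigPoly.ev (headP x (normalForm m γ n p.1)) δ :=
      funext fun z => (ev_tailP_add_headP x _ δ z).symm
    have hT : TrigPoly.SmoothAt (tailP x (normalForm m γ n p.1)) δ := ((stage_good m γ n δ n _ hp1).filter _).2
    have hH : TrigPoly.SmoothAt (headP x (normalForm m γ n p.1)) δ := ((stage_good m γ n δ n _ hp1).filter _).2
    rw [e, poisson_add_left (TrigPoly.differentiable_ev _ fun s hs => (hT s hs).differentiable)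
      (TrigPoly.differentiable_ev _ fun s hs => (hH s hs).differentiable), poisson_head_tail_eq_zero hδ hr hp1 hp2 hnr q,
      add_zero]
  rw [Finset.sum_congr rfl hsplit]
  exact sum_antidiagonal_poisson_self (fun i => TrigPoly.ev (tailP x (normalForm m γ n i)) δ) l (q, w)

/-! ### Lemma 4 (1): the coefficients of `H̃ · H̃_{>a}` vanish off `Z` -/

/-- `ev H̃_{>a}^{(j)}` as a function: `∑_x ϑ_{a,x}(ω) ev H̃^{(j)}_{>x} + ϑ_*(ω) ev H̃^{(j)}_{>a}`. [cite: DeRoeckHuveneers2015, §5.1 (definition of `H̃_{>a}`)] -/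
theorem ev_hgtPoly_eq (j : ℕ) (δ : ℝ) :
    TrigPoly.ev (hgtPoly Θ b n₃ γ n j) δ = fun z =>
      ∑ x ∈ nearSites b n₃, vt Θ b n₃ x δ z.2 * TrigPoly.ev (tailP x (normalForm m γ n j)) δ z +
        vtStar Θ b n₃ δ z.2 * TrigPoly.ev (tailP b (normalForm m γ n j)) δ z := by
  funext z
  unfold hgtPoly
  rw [TrigPoly.ev_append, ev_flatMap_toList]
  simp only [TrigPoly.ev_smulFun]

/-- **Lemma 4, first claim, coefficient level: off `Z`, `(H̃ · H̃_{>a})_l (q, ω) = 0` for all `q`** — by the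
crucial cancellation where `ϑ_{a,x} ≠ 0` and the vanishing of `{H̃, ϑ}` and of `ϑ_*` off `Z`.
[cite: DeRoeckHuveneers2015, §5.5 Lemma 4, first claim ("If `L_H̃ H̃_{>a}(ω,q) ≠ 0`, then `(ω,q) ∈ Z`")] -/
theorem mul_hgt_coeff_eq_zero (hδ : 0 < δ) (hδ1 : δ ≤ 1) (hr : IsSchemeRadius n r) (hroom : HasRoom Θ.RS n₂ b n₃)
    {Rz : ℕ} (hRz : n₃ + Θ.RS ≤ Rz) {w : Fin m → ℝ}
    (hw : w ∉ Zset m r n₂ b Rz ((L : ℝ) ^ (n₂ + 1) * δ)) (q : Fin m → ℝ) (l : ℕ) :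
    ((TruncSeries.qOp (genFun m γ n δ) n (hamTS m γ n) * hgtTS Θ b n₃ γ n δ).coeff l).val (q, w) = 0 := by
  by_cases hl : l ≤ n
  swap
  · rw [TruncSeries.coeff_eq_zero _ (not_le.1 hl)]; rfl
  obtain ⟨-, hmr⟩ := good_of_not_mem_Zset hδ hδ1 hroom hRz hw
  have hstar := vtStar_eq_zero_of_not_mem_Zset hδ hδ1 hroom hRz hw
  rw [TruncSeries.coeff_mul_of_le _ _ hl, SmoothFun.val_sum]
  dsimp only
  simp only [SmoothFun.val_lie]
  -- each bracket `{H̃_i, Hgt_j}` reduces to `∑_x ϑ_x {H̃_i, T^x_j}`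
  have hred : ∀ p ∈ antidiagonal l,
      poisson ((TruncSeries.qOp (genFun m γ n δ) n (hamTS m γ n)).coeff p.1).val ((hgtTS Θ b n₃ γ n δ).coeff p.2).val (q, w) =
      ∑ x ∈ nearSites b n₃, vt Θ b n₃ x δ w *
        poisson (TrigPoly.ev (normalForm m γ n p.1) δ) (TrigPoly.ev (tailP x (normalForm m γ n p.2)) δ) (q, w) := by
    intro p hp
    have hp' := Finset.mem_antidiagonal.1 hp
    have hp1 : p.1 ≤ n := by omega
    have hp2 : p.2 ≤ n := by omega
    rw [normalForm_represents m γ n δ p.1 hp1, val_hgtTS_coeff hδ hδ1 hp2, ev_hgtPoly_eq]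
    have hT : ∀ x, Differentiable ℝ (TrigPoly.ev (tailP x (normalForm m γ n p.2)) δ) := fun x =>
      TrigPoly.differentiable_ev _ fun s hs => ((((stage_good m γ n δ n _ hp2).filter _).2) s hs).differentiable
    have hvt : ∀ x, Differentiable ℝ (fun z : PhaseSpace m => vt Θ b n₃ x δ z.2) := fun x =>
      ((contDiff_vt hδ hδ1 x).differentiable (by simp)).comp differentiable_snd
    have hvs : Differentiable ℝ (fun z : PhaseSpace m => vtStar Θ b n₃ δ z.2) :=
      ((contDiff_vtStar hδ hδ1).differentiable (by simp)).comp differentiable_snd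
    have e1 : (fun z : PhaseSpace m => ∑ x ∈ nearSites b n₃, vt Θ b n₃ x δ z.2 * TrigPoly.ev (tailP x (normalForm m γ n p.2)) δ z +
        vtStar Θ b n₃ δ z.2 * TrigPoly.ev (tailP b (normalForm m γ n p.2)) δ z) =
        (fun z => ∑ x ∈ nearSites b n₃, ((fun z : PhaseSpace m => vt Θ b n₃ x δ z.2) * TrigPoly.ev (tailP x (normalForm m γ n p.2)) δ) z) +
          ((fun z : PhaseSpace m => vtStar Θ b n₃ δ z.2) * TrigPoly.ev (tailP b (normalForm m γ n p.2)) δ) := by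
      funext z; simp
    rw [e1, poisson_add_right _ (Differentiable.fun_sum fun x _ => (hvt x).mul (hT x)) (hvs.mul (hT b)),
      poisson_sum_right _ _ (fun x _ => (hvt x).mul (hT x)), poisson_mul_right _ hvs (hT b)]
    simp only [poisson_mul_right _ (hvt _) (hT _)]
    rw [poisson_normalForm_vtStar_eq_zero hδ hδ1 hr hp1 hmr q, hstar]
    simp only [zero_mul, mul_zero, add_zero]
    refine Finset.sum_congr rfl fun x hx => ?_
    rw [poisson_normalForm_vt_eq_zero hδ hδ1 hr hp1 hx hmr q, mul_zero, add_zero]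
  rw [Finset.sum_congr rfl hred, Finset.sum_comm]
  refine Finset.sum_eq_zero fun x hx => ?_
  rw [← Finset.mul_sum]
  by_cases hv : vt Θ b n₃ x δ w = 0
  · rw [hv, zero_mul]
  · rw [cancellation hδ hr hl (Θ.nonres_of_pos δ hδ hδ1 x w (theta_pos_of_vt_ne_zero hx hv)) q, mul_zero]

/-! ### Propagation through `R` and `𝒯`: `A = 0` off `Z` -/

/-- A smooth function vanishing on the open set `Ω_m × Zᶜ`. [folklore] -/
def VanishesOff (Z : Set (Fin m → ℝ)) (f : SmoothFun m) : Prop := ∀ z : PhaseSpace m, z.2 ∉ Z → f.val z = 0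

/-- Brackets preserve vanishing off a closed `Z` (the bracket only sees the gradient). [cite: DeRoeckHuveneers2015, §5.5 proof of Lemma 4 ("since `L_H̃` is a differential operator")] -/
theorem VanishesOff.lie {Z : Set (Fin m → ℝ)} (hZ : IsClosed Z) (u : SmoothFun m) {f : SmoothFun m}
    (h : VanishesOff Z f) : VanishesOff Z ⁅u, f⁆ := by
  intro z hz
  rw [SmoothFun.val_lie]
  refine poisson_eq_zero_of_fderiv_eq_zero u.differentiable f.differentiable ?_
  have hopen : IsOpen {z' : PhaseSpace m | z'.2 ∉ Z} := (hZ.isOpen_compl).preimage continuous_snd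
  have hev : f.val =ᶠ[𝓝 z] fun _ => 0 := by
    filter_upwards [hopen.mem_nhds hz] with z' hz'
    exact h z' hz'
  rw [hev.fderiv_eq]; simp

/-- Iterated brackets preserve vanishing. [folklore] -/
theorem VanishesOff.adPow {Z : Set (Fin m → ℝ)} (hZ : IsClosed Z) (u : SmoothFun m) :
    ∀ (i : ℕ) {f : SmoothFun m}, VanishesOff Z f → VanishesOff Z ((fun x : SmoothFun m => ⁅u, x⁆)^[i] f) := by
  intro i
  induction i with
  | zero => intro f h; exact h
  | succ i ih => intro f h; rw [Function.iterate_succ_apply']; exact (ih h).lie hZ u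

/-- Sums preserve vanishing. [folklore] -/
theorem VanishesOff.sum {Z : Set (Fin m → ℝ)} {ι : Type*} (s : Finset ι) {f : ι → SmoothFun m}
    (h : ∀ i ∈ s, VanishesOff Z (f i)) : VanishesOff Z (∑ i ∈ s, f i) := by
  intro z hz
  rw [SmoothFun.val_sum]
  exact Finset.sum_eq_zero fun i hi => h i hi z hz

/-- Scalar multiples preserve vanishing. [folklore] -/
theorem VanishesOff.smul {Z : Set (Fin m → ℝ)} (c : ℝ) {f : SmoothFun m} (h : VanishesOff Z f) : VanishesOff Z (c • f) := by
  intro z hz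
  rw [SmoothFun.val_smul, Pi.smul_apply, h z hz, smul_zero]

/-- `e^{ε^p ad u}` preserves vanishing of all coefficients. [folklore] -/
theorem VanishesOff.expOp {Z : Set (Fin m → ℝ)} (hZ : IsClosed Z) {p : ℕ} (hp : 1 ≤ p) (u : SmoothFun m)
    {F : TruncSeries (SmoothFun m) n} (h : ∀ j, VanishesOff Z (F.coeff j)) :
    ∀ j, VanishesOff Z ((TruncSeries.expOp p u F).coeff j) := by
  intro j
  by_cases hj : j ≤ n
  · rw [TruncSeries.expOp_coeff hp u F hj]
    refine VanishesOff.sum _ fun i _ => ?_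
    by_cases hij : i * p ≤ j
    · rw [if_pos hij]; exact ((h _).adPow hZ u i).smul _
    · rw [if_neg hij]; intro z _; rfl
  · rw [TruncSeries.coeff_eq_zero _ (not_le.1 hj)]; intro z _; rfl

/-- `R` preserves vanishing of all coefficients. [cite: DeRoeckHuveneers2015, §5.6 ("the function `L_H̃ H̃_{>a}` vanishes on the open set `Ω ∖ Z`, so that `∂_♯ 𝒯_{n₁}(R L_H̃ H̃_{>a})` vanishes on this set as well")] -/
theorem VanishesOff.rOp {Z : Set (Fin m → ℝ)} (hZ : IsClosed Z) (u : ℕ → SmoothFun m) :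
    ∀ (k : ℕ) {F : TruncSeries (SmoothFun m) n}, (∀ j, VanishesOff Z (F.coeff j)) →
      ∀ j, VanishesOff Z ((TruncSeries.rOp u k F).coeff j) := by
  intro k
  induction k with
  | zero => intro F h; exact h
  | succ k ih =>
    intro F h
    rw [TruncSeries.rOp_succ]
    exact ih (VanishesOff.expOp hZ (Nat.succ_pos k) _ h)

/-- `𝒯_n` (evaluation at `ε`) preserves vanishing. [folklore] -/
theorem VanishesOff.eval {Z : Set (Fin m → ℝ)} (ε : ℝ) {F : TruncSeries (SmoothFun m) n} (h : ∀ j, VanishesOff Z (F.coeff j)) :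
    VanishesOff Z (TruncSeries.eval ε F) := by
  intro z hz
  rw [SmoothFun.val_eval]
  exact Finset.sum_eq_zero fun j _ => by rw [h j z hz, mul_zero]

/-- **`A = 0` off `Z`**: the resonant term `A = 𝒯(R(H̃ · H̃_{>a}))` vanishes at every `(q, ω)` with
`ω ∉ Z`. [cite: DeRoeckHuveneers2015, §5.5 Lemma 4, first claim, and §5.6 ("the function `L_H̃ H̃_{>a}` vanishes on the open set `Ω ∖ Z`, so that `∂_♯ 𝒯_{n₁}(R L_H̃ H̃_{>a})` vanishes on this set as well")] -/
theorem Aterm_eq_zero_of_not_mem_Zset (hδ : 0 < δ) (hδ1 : δ ≤ 1) (hr : IsSchemeRadius n r) (hroom : HasRoom Θ.RS n₂ b n₃)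
    {Rz : ℕ} (hRz : n₃ + Θ.RS ≤ Rz) (ε : ℝ) {z : PhaseSpace m}
    (hz : z.2 ∉ Zset m r n₂ b Rz ((L : ℝ) ^ (n₂ + 1) * δ)) : Aterm Θ b n₃ γ n ε δ z = 0 := by
  have hX : ∀ j, VanishesOff (Zset m r n₂ b Rz ((L : ℝ) ^ (n₂ + 1) * δ))
      ((TruncSeries.qOp (genFun m γ n δ) n (hamTS m γ n) * hgtTS Θ b n₃ γ n δ).coeff j) := by
    intro j z' hz'
    have := mul_hgt_coeff_eq_zero (Θ := Θ) (γ := γ) hδ hδ1 hr hroom hRz hz' z'.1 j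
    simpa using this
  exact (VanishesOff.rOp (isClosed_Zset m r n₂ b Rz _) (genFun m γ n δ) n hX |> VanishesOff.eval ε) z hz

end Main

end Literature.Barriers.AtomisticToContinuum.HeatConduction.RotorChain

end
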